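/-
Copyright (c) 2026. All rights reserved.
Released under Apache 2.0 license as described in the file LICENSE.
Authors: hodgecm-mathlib cell (D-0151), fan A, seat A-p10.
-/
import Literature.NumberTheory.Automorphic.SiegelEisensteinReindex
import Mathlib.GroupTheory.GroupAction.Quotient
import HarnessLib

/-!
# The Siegel–Eisenstein coset sum is invariant under the rational group: `E(r(γ)Ψ) = E(Ψ)` for `γ ∈ H`

Topic `NumberTheory/Automorphic`; namespace `Literature.NumberTheory.Automorphic.SiegelEisenstein` (continues
`SiegelEisensteinReindex`, SAME SPELLING: a group `R` acting on `S` by `act` with `act (a * b) = act a ∘ act b`, subgroups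
`H P ≤ R`, a functional `ev0 : S → M` with `ev0 (act p Ψ) = ev0 Ψ` for `p ∈ P`, and the Eisenstein sum
`E(Ψ) = ∑' q : H ⧸ P.subgroupOf H, ev0 (act (q.out)⁻¹ Ψ)` — the child line's `eis` UNFOLDED, since a Literature file cannot import
a Lines file).  KERNEL ONLY: theorems over Mathlib; no definition, no named fact, no instance, no `sorry`.

THE PRINT. [Weil1965, n° 39 (30) p. 57; n° 41]: `E(Φ) = Σ_{γ ∈ P(k)\G(k)} (r(γ)Φ)(0)` is a sum over ALL of `P(k)\G(k)`, so for
`γ₀ ∈ G(k)` the substitution `γ ↦ γ γ₀` permutes the cosets and `E(r(γ₀)Φ) = E(Φ)` — the Eisenstein–Siegel series is invariant under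
the rational points ([Kudla1994, §3]: `E(g, s, Φ)` is left `G(k)`-invariant).  In the tree's left-coset spelling: the term of `act γ Ψ`
at the coset `q` is the term of `Ψ` at the coset `γ⁻¹ • q` (Mathlib's action of `H` on `H ⧸ P.subgroupOf H` by left multiplication),
and `q ↦ γ⁻¹ • q` is a permutation, so the `tsum` (and `HasSum`/`Summable`) are unchanged — with NO summability hypothesis.

* `apply_act_out_inv_act_eq` — `ev0 (act (q.out)⁻¹ (act γ Ψ)) = ev0 (act ((γ⁻¹ • q).out)⁻¹ Ψ)` (`γ ∈ H`);
* **`tsum_quotient_act_eq`** — `E(act γ Ψ) = E(Ψ)` for `γ : H`; `hasSum_quotient_act_iff`, **`summable_quotient_act_iff`**;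
  the `(γ : R) (hγ : γ ∈ H)` spellings `tsum_quotient_act_eq_of_mem` / `summable_quotient_act_iff_of_mem` / `hasSum_quotient_act_iff_of_mem`.

USE (cell `hodgecm-mathlib`, FLOOR-0 P4, ENGINE E-2 child `Cruxes/H413/Lines/F0_E2SiegelWeilWeilRange.lean`, `stub_SW2_siegelWeil`, road (W),
row EIS-INV of F0P4-plan (g3) 01:52:21Z): the EISENSTEIN half of «`E'' = I□ − κ·eis` is `IW(F)`-invariant» (`H = IW(F)`, `P = PW(F)`,
`act = actRat`, `ev0` the origin value of the `δ`-frame) consumed by the bound (C2) and the pen's I-CLOSE; the theta half is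
`Theorems/H413E2SWThetaIntegralRationalInvariance` (F0P4-p02).  HC_CM is proved only modulo the printed citations until rung 0 closes.

## References
* [Weil1965] A. Weil, *Sur la formule de Siegel dans la théorie des groupes classiques*, Acta Math. 113 (1965): n° 39 (30) p. 57,
  n° 41 (the Eisenstein–Siegel series as a `Ps(X)_k`-invariant tempered distribution).
* [Kudla1994] S. S. Kudla, Israel J. Math. 87 (1994) 361–401, §3 (left `G(k)`-invariance of the Siegel Eisenstein series).
-/

set_option autoImplicit false

noncomputable section

namespace Literature.NumberTheory.Automorphic.SiegelEisenstein

variable {R : Type*} [Group R] {S : Type*} (act : R → S → S) (H P : Subgroup R) {M : Type*} (ev0 : S → M)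

/-! ## §1 The term of `act γ Ψ` at `q` is the term of `Ψ` at `γ⁻¹ • q` -/

/-- **translation of the index**: for `γ ∈ H` and a coset `q ∈ H ⧸ (P ⊓ H)`, the Eisenstein term of `act γ Ψ` at `q` equals the
term of `Ψ` at the coset `γ⁻¹ • q` (left multiplication; representative independence from `ev0 ∘ act p = ev0`, `p ∈ P`).
[cite: Weil1965, n° 39 (30) p. 57] -/
theorem apply_act_out_inv_act_eq (hmul : ∀ (a b : R) (Ψ : S), act (a * b) Ψ = act a (act b Ψ))
    (hP : ∀ p ∈ P, ∀ Ψ : S, ev0 (act p Ψ) = ev0 Ψ) (γ : H) (Ψ : S) (q : H ⧸ P.subgroupOf H) :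
    ev0 (act ((Quotient.out q : H) : R)⁻¹ (act (γ : R) Ψ)) =
      ev0 (act ((Quotient.out (γ⁻¹ • q) : H) : R)⁻¹ Ψ) := by
  have hq : γ⁻¹ • q = (QuotientGroup.mk (γ⁻¹ * Quotient.out q) : H ⧸ P.subgroupOf H) := by
    rw [← MulAction.Quotient.mk_smul_out, smul_eq_mul]
  rw [hq, apply_act_out_inv_eq act H P ev0 hmul hP Ψ (γ⁻¹ * Quotient.out q), Subgroup.coe_mul, Subgroup.coe_inv,
    mul_inv_rev, inv_inv, hmul]

/-! ## §2 Invariance of the coset sum under `H` -/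

/-- **`E(act γ Ψ) = E(Ψ)` for `γ ∈ H`** — the Siegel–Eisenstein coset sum is invariant under the whole rational group, with NO
summability hypothesis (`tsum` transported along the permutation `q ↦ γ⁻¹ • q` of `H ⧸ (P ⊓ H)`).
[cite: Weil1965, n° 39 (30) p. 57] [cite: Kudla1994, §3] -/
theorem tsum_quotient_act_eq [AddCommMonoid M] [TopologicalSpace M]
    (hmul : ∀ (a b : R) (Ψ : S), act (a * b) Ψ = act a (act b Ψ)) (hP : ∀ p ∈ P, ∀ Ψ : S, ev0 (act p Ψ) = ev0 Ψ)
    (γ : H) (Ψ : S) :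
    ∑' q : H ⧸ P.subgroupOf H, ev0 (act ((Quotient.out q : H) : R)⁻¹ (act (γ : R) Ψ)) =
      ∑' q : H ⧸ P.subgroupOf H, ev0 (act ((Quotient.out q : H) : R)⁻¹ Ψ) := by
  have hfun : (fun q : H ⧸ P.subgroupOf H => ev0 (act ((Quotient.out q : H) : R)⁻¹ (act (γ : R) Ψ))) =
      fun q => (fun q' : H ⧸ P.subgroupOf H => ev0 (act ((Quotient.out q' : H) : R)⁻¹ Ψ)) (MulAction.toPerm (γ⁻¹ : H) q) :=
    funext fun q => by rw [MulAction.toPerm_apply]; exact apply_act_out_inv_act_eq act H P ev0 hmul hP γ Ψ q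
  rw [hfun]
  exact Equiv.tsum_eq (MulAction.toPerm (γ⁻¹ : H)) (fun q' : H ⧸ P.subgroupOf H => ev0 (act ((Quotient.out q' : H) : R)⁻¹ Ψ))

/-- `HasSum` form of the invariance. [cite: Weil1965, n° 39 (30) p. 57] -/
theorem hasSum_quotient_act_iff [AddCommMonoid M] [TopologicalSpace M]
    (hmul : ∀ (a b : R) (Ψ : S), act (a * b) Ψ = act a (act b Ψ)) (hP : ∀ p ∈ P, ∀ Ψ : S, ev0 (act p Ψ) = ev0 Ψ)
    (γ : H) (Ψ : S) (m : M) :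
    HasSum (fun q : H ⧸ P.subgroupOf H => ev0 (act ((Quotient.out q : H) : R)⁻¹ (act (γ : R) Ψ))) m ↔
      HasSum (fun q : H ⧸ P.subgroupOf H => ev0 (act ((Quotient.out q : H) : R)⁻¹ Ψ)) m := by
  have hfun : (fun q : H ⧸ P.subgroupOf H => ev0 (act ((Quotient.out q : H) : R)⁻¹ (act (γ : R) Ψ))) =
      (fun q' : H ⧸ P.subgroupOf H => ev0 (act ((Quotient.out q' : H) : R)⁻¹ Ψ)) ∘ (MulAction.toPerm (γ⁻¹ : H)) :=
    funext fun q => by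
      rw [Function.comp_apply, MulAction.toPerm_apply]
      exact apply_act_out_inv_act_eq act H P ev0 hmul hP γ Ψ q
  rw [hfun]
  exact (MulAction.toPerm (γ⁻¹ : H)).hasSum_iff

/-- **`Summable` form of the invariance**: the Eisenstein sum of `act γ Ψ` converges (absolutely, with `ev0 := ‖·‖ ∘ ev0`) iff
that of `Ψ` does. [cite: Weil1965, n° 39 (30) p. 57] -/
theorem summable_quotient_act_iff [AddCommMonoid M] [TopologicalSpace M]
    (hmul : ∀ (a b : R) (Ψ : S), act (a * b) Ψ = act a (act b Ψ)) (hP : ∀ p ∈ P, ∀ Ψ : S, ev0 (act p Ψ) = ev0 Ψ)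
    (γ : H) (Ψ : S) :
    Summable (fun q : H ⧸ P.subgroupOf H => ev0 (act ((Quotient.out q : H) : R)⁻¹ (act (γ : R) Ψ))) ↔
      Summable (fun q : H ⧸ P.subgroupOf H => ev0 (act ((Quotient.out q : H) : R)⁻¹ Ψ)) :=
  ⟨fun ⟨m, hm⟩ => ⟨m, (hasSum_quotient_act_iff act H P ev0 hmul hP γ Ψ m).1 hm⟩,
    fun ⟨m, hm⟩ => ⟨m, (hasSum_quotient_act_iff act H P ev0 hmul hP γ Ψ m).2 hm⟩⟩

/-! ## §3 The same with `γ : R`, `γ ∈ H` -/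

/-- `E(act γ Ψ) = E(Ψ)` for `γ ∈ H` given as an element of `R`. [cite: Weil1965, n° 39 (30) p. 57] [cite: Kudla1994, §3] -/
theorem tsum_quotient_act_eq_of_mem [AddCommMonoid M] [TopologicalSpace M]
    (hmul : ∀ (a b : R) (Ψ : S), act (a * b) Ψ = act a (act b Ψ)) (hP : ∀ p ∈ P, ∀ Ψ : S, ev0 (act p Ψ) = ev0 Ψ)
    {γ : R} (hγ : γ ∈ H) (Ψ : S) :
    ∑' q : H ⧸ P.subgroupOf H, ev0 (act ((Quotient.out q : H) : R)⁻¹ (act γ Ψ)) =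
      ∑' q : H ⧸ P.subgroupOf H, ev0 (act ((Quotient.out q : H) : R)⁻¹ Ψ) :=
  tsum_quotient_act_eq act H P ev0 hmul hP ⟨γ, hγ⟩ Ψ

/-- `HasSum` form with `γ ∈ H` given as an element of `R`. [cite: Weil1965, n° 39 (30) p. 57] -/
theorem hasSum_quotient_act_iff_of_mem [AddCommMonoid M] [TopologicalSpace M]
    (hmul : ∀ (a b : R) (Ψ : S), act (a * b) Ψ = act a (act b Ψ)) (hP : ∀ p ∈ P, ∀ Ψ : S, ev0 (act p Ψ) = ev0 Ψ)
    {γ : R} (hγ : γ ∈ H) (Ψ : S) (m : M) :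
    HasSum (fun q : H ⧸ P.subgroupOf H => ev0 (act ((Quotient.out q : H) : R)⁻¹ (act γ Ψ))) m ↔
      HasSum (fun q : H ⧸ P.subgroupOf H => ev0 (act ((Quotient.out q : H) : R)⁻¹ Ψ)) m :=
  hasSum_quotient_act_iff act H P ev0 hmul hP ⟨γ, hγ⟩ Ψ m

/-- `Summable` form with `γ ∈ H` given as an element of `R`. [cite: Weil1965, n° 39 (30) p. 57] -/
theorem summable_quotient_act_iff_of_mem [AddCommMonoid M] [TopologicalSpace M]
    (hmul : ∀ (a b : R) (Ψ : S), act (a * b) Ψ = act a (act b Ψ)) (hP : ∀ p ∈ P, ∀ Ψ : S, ev0 (act p Ψ) = ev0 Ψ)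
    {γ : R} (hγ : γ ∈ H) (Ψ : S) :
    Summable (fun q : H ⧸ P.subgroupOf H => ev0 (act ((Quotient.out q : H) : R)⁻¹ (act γ Ψ))) ↔
      Summable (fun q : H ⧸ P.subgroupOf H => ev0 (act ((Quotient.out q : H) : R)⁻¹ Ψ)) :=
  summable_quotient_act_iff act H P ev0 hmul hP ⟨γ, hγ⟩ Ψ

/-- **difference form** (the shape the bound consumes, `E'' = I − E`): for a functional `I` with `I (act γ Ψ) = I Ψ` and the
Eisenstein sum with any coefficient `ev0'` (e.g. `κ • ev0`) valued in an additive commutative group,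
`I (act γ Ψ) - E(act γ Ψ) = I Ψ - E(Ψ)`. [cite: Weil1965, n° 41] -/
theorem sub_tsum_quotient_act_eq {N : Type*} [AddCommGroup N] [TopologicalSpace N] (ev0' : S → N)
    (hmul : ∀ (a b : R) (Ψ : S), act (a * b) Ψ = act a (act b Ψ)) (hP : ∀ p ∈ P, ∀ Ψ : S, ev0' (act p Ψ) = ev0' Ψ)
    (I : S → N) (γ : H) (Ψ : S) (hI : I (act (γ : R) Ψ) = I Ψ) :
    I (act (γ : R) Ψ) - ∑' q : H ⧸ P.subgroupOf H, ev0' (act ((Quotient.out q : H) : R)⁻¹ (act (γ : R) Ψ)) =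
      I Ψ - ∑' q : H ⧸ P.subgroupOf H, ev0' (act ((Quotient.out q : H) : R)⁻¹ Ψ) := by
  rw [hI, tsum_quotient_act_eq act H P ev0' hmul hP γ Ψ]

end Literature.NumberTheory.Automorphic.SiegelEisenstein
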